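import Summits.BirchSwinnertonDyer.Rank1Residual.ManinAdditive.TwistingIsogenyAtThree
import Literature.NumberTheory.EllipticCurves.LatticeInclusionIsogenyComplexPointsProofs
import HarnessLib
import HarnessLib.Audit.Tags

/-!
# E-desc-58 `TwistingIsogenyDegreeAtThree` and E-desc-59 `FlipExactThreeIsogenyAtThree` ARE THEOREMS — the twisting
# isogeny of degree `a · deg φ / deg φ′` on a same-level optimal `χ_d`-orbit, from the PERIOD-LATTICE index engine
# (cell `bsd-f2-manin`, crux C3 `ManinPrimeToThreeAtNine` stmt-BirchSwinnertonDyer-22968; desc's THEOREM TARGETS of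
# `TwistingIsogenyAtThree.lean`, MEMO-desc §26; C2/C3 LEAD `bsd-line-manin23-p1` gen 8)

Summit `BirchSwinnertonDyer`, route `ManinLocalTwoThree`.  desc g9 proved on paper (MEMO-desc §26.1, refuter-1 §R69 VALID)
that the twisting endomorphism `D = t_{1/3} − t_{1/3}²` of `J₀(N)` restricts to an isogeny `W ⊗ (−3) → W′` of degree
`3 · deg φ_W / deg φ_{W′}` between the two OPTIMAL curves of a same-level `χ₋₃`-orbit at `9 ∣ N` (E-desc-58), hence of
degree exactly `3` on a FLIP orbit (E-desc-59).  The tree has no Rosati involution / polarisation degrees on `J₀(N)`; but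
it has the an-lens's PERIOD-LATTICE INDEX ENGINE (`TwistOrbitIndexEngine`, THM B machinery: `optimal_orbit_index_engine`,
`mulLeft_lattice_le_of_optimal`, `norm_sq_mul_covolume_eq_relIndex_mul`) and the analytic-isogeny bridge
`exists_isogeny_degree_eq_relIndex_of_isNeronLatticeOf` (Silverman *AEC* VI.4.1(b) + `ℚ`-descent), which give the SAME
isogeny degrees without any endomorphism of `J₀(N)`:

* `optimal_orbit_exists_isogeny_degree_mul` (general engine form): same level, both data lattice-optimal, two-sided twist
  steps `sΛ(f′) ⊆ Λ(f)`, `sΛ(f) ⊆ Λ(f′)` with `s² = d`, `‖s‖² = a`, and `|aₙ(f′)| = |aₙ(f)|`.  Let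
  `m := [Λ_W : (cs/c′)Λ_{W′}]` (the engine's index, `m · deg′ = a · deg`).  Then `m·Λ_W ⊆ (cs/c′)Λ_{W′}`, i.e. with the
  Néron-type pair `Λ_T = s⁻¹Λ_W` of `T = W ⊗ d` (`isNeronLatticeOf_quadraticTwist_of_sq_eq`) the RATIONAL homothety
  `(m c′/c) · Λ_T ⊆ Λ_{W′}` holds; it is a `ℚ`-isogeny `T → W′` of degree `[Λ_{W′} : (mc′/c)Λ_T] = m² / m = m`
  (covolumes), so `deg · deg′ = m · deg′ = a · deg`.  No case split (commuting / flip), no Mazur–Kenku.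
* `pStar_optimal_orbit_exists_isogeny_degree_mul`: the `q*`-instance (`q` odd prime, `q² ∣ N`, `s` = the quadratic Gauss
  sum, `s² = q*`, `‖s‖² = q`; steps from the tree's `pStar_orbit_steps`), packaged with the flip clause
  `deg φ_{W′} = deg φ_W` of `optimal_flip_modularDegree_eq`.
* `twistingIsogenyDegreeAtThree_holds : TwistingIsogenyDegreeAtThree` (E-desc-58 BY NAME, `q = 3`, `q* = −3`) and
  `flipExactThreeIsogenyAtThree_holds : FlipExactThreeIsogenyAtThree` (E-desc-59 BY NAME, via desc's proved edge
  `exists_isogeny_degree_three_of_modularDegree_eq` and the an-lens's `optimal_flip_modularDegree_eq`).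

HONEST FRAMING: these are statements about modular degrees and isogeny degrees on twist orbits of OPTIMAL curves (the
`ModularParametrizationData` inhabitation caveat of the whole cell applies: the data are hypotheses, modularity is not
constructed); they prove nothing about BSD, nothing about Manin's conjecture, and do not close C3 — they retire two typed
open obligations (E-desc-58/59) of the cell's twist-orbit bookkeeping at `9 ∣ N` (line `kato_shift_three`, stub 5 /
RES₃♭ orbit-minimality clauses).  desc's Galois-module reading of the orientation (`A★[3] ⊆ J₀(N)^{t_{1/3}}`,
MEMO-desc §26.3) is NOT captured by the lattice proof.

References: [SilvermanAEC2009] Thm. VI.4.1(b); [ZagierCMB1985] §1; [Pal2012] Lemma 3.1; [Stevens1989] (5.4)–(5.5);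
cell memos MEMO-desc §26, MEMO-an §24–§25.
-/

set_option autoImplicit false
-- `Summit.BirchSwinnertonDyer.BirchSwinnertonDyer` is the mandated summit-side namespace (single-conjunct summit).
set_option linter.dupNamespace false

noncomputable section

open scoped Classical MatrixGroups ModularForm

open CongruenceSubgroup WeierstrassCurve
  Literature.NumberTheory.EllipticCurves Literature.NumberTheory.EllipticCurves.ModularForms
  Summit.BirchSwinnertonDyer.Rank1Residual.ManinAdditive
  Summit.BirchSwinnertonDyer.Rank1Residual.ManinAdditive.TwistingIsogenyAtThree

namespace Summit.BirchSwinnertonDyer.BirchSwinnertonDyer.Theorems.ManinLocalTwoThree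

/-- **The twisting isogeny from the index engine (general orbit form).**  Same level, `D, D′` lattice-optimal, two-sided
twist steps with `s² = d`, `‖s‖² = a`, `|aₙ(f′)| = |aₙ(f)|`: there is a `ℚ`-isogeny `φ : W ⊗ d → W′` with
`deg φ · deg(D′) = a · deg(D)` — namely the rational homothety `(m c′/c)·Λ_{W ⊗ d} ⊆ Λ_{W′}`,
`m = [Λ_W : (cs/c′)Λ_{W′}]`, of degree `m`. [cite: SilvermanAEC2009, Thm. VI.4.1(b)] [cite: Pal2012, Lemma 3.1] -/
theorem optimal_orbit_exists_isogeny_degree_mul {W W' : WeierstrassCurve ℚ} [W.IsElliptic] [W'.IsElliptic]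
    {N N' : ℕ} [NeZero N] [NeZero N'] (hNN : N' = N) (D : ModularParametrizationData W N)
    (D' : ModularParametrizationData W' N') (hD : IsLatticeOptimal D) (hD' : IsLatticeOptimal D')
    {d : ℚ} (hd : d ≠ 0) {s : ℂ} (hs0 : s ≠ 0) (hs : s ^ 2 = (d : ℂ)) {a : ℕ} (ha : ‖s‖ ^ 2 = a)
    (h1 : ∀ w ∈ periodLattice D'.f, s * w ∈ periodLattice D.f)
    (h2 : ∀ w ∈ periodLattice D.f, s * w ∈ periodLattice D'.f)
    (hcoef : ∀ n : ℕ, ‖cuspCoeff D'.f n‖ = ‖cuspCoeff D.f n‖) :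
    ∃ φ : Isogeny (W.quadraticTwist d) W', φ.degree * D'.modularDegree = a * D.modularDegree := by
  haveI := W.isElliptic_quadraticTwist hd
  have hc0 : (D.c : ℂ) ≠ 0 := D.cast_c_ne_zero
  have hc0' : (D'.c : ℂ) ≠ 0 := D'.cast_c_ne_zero
  have hcq : (D.c : ℚ) ≠ 0 := by exact_mod_cast (Int.cast_ne_zero.mp hc0)
  have hcq' : (D'.c : ℚ) ≠ 0 := by exact_mod_cast (Int.cast_ne_zero.mp hc0')
  have ht : (D.c : ℂ) * s / (D'.c : ℂ) ≠ 0 := div_ne_zero (mul_ne_zero hc0 hs0) hc0'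
  have ht' : (D'.c : ℂ) * s / (D.c : ℂ) ≠ 0 := div_ne_zero (mul_ne_zero hc0' hs0) hc0
  obtain ⟨-, hmdeg⟩ := optimal_orbit_index_engine hNN D D' hD hD' ha h1 h2 hcoef ht ht'
  set m : ℕ := (D'.L.mulLeft _ ht).lattice.toAddSubgroup.relIndex D.L.lattice.toAddSubgroup with hm_def
  -- positivity bookkeeping
  have ha0 : (a : ℝ) ≠ 0 := by
    rw [← ha]; exact pow_ne_zero 2 (norm_ne_zero_iff.mpr hs0)
  have haN : a ≠ 0 := by exact_mod_cast ha0
  have hm0 : m ≠ 0 := by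
    intro h
    rw [h, zero_mul] at hmdeg
    exact (mul_ne_zero haN D.deg_pos.ne') hmdeg.symm
  -- inclusion B of the engine: `(cs/c′)Λ_{W′} ⊆ Λ_W`, index `m`
  have hB : (D'.L.mulLeft _ ht).lattice ≤ D.L.lattice := mulLeft_lattice_le_of_optimal D D' hD' h1 ht
  -- the Néron-type pair `Λ_T = s⁻¹Λ_W` of `T = W ⊗ d`
  have hT := isNeronLatticeOf_quadraticTwist_of_sq_eq d D.isNeronLattice hs0 hs
  -- the rational multiplier `r = m c′ / c`
  set r : ℚ := (m : ℚ) * (D'.c : ℚ) / (D.c : ℚ) with hr_def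
  have hrq : r ≠ 0 := div_ne_zero (mul_ne_zero (by exact_mod_cast hm0) hcq') hcq
  have hrC : ((r : ℚ) : ℂ) ≠ 0 := by exact_mod_cast hrq
  have hle : ∀ z ∈ (D.L.mulLeft s⁻¹ (inv_ne_zero hs0)).lattice, ((r : ℚ) : ℂ) * z ∈ D'.L.lattice := by
    intro z hz
    have hsz : s * z ∈ D.L.lattice := by
      have := PeriodPair.mem_mulLeft_lattice.mp hz
      rwa [inv_inv] at this
    have hmem : m • (s * z) ∈ (D'.L.mulLeft _ ht).lattice.toAddSubgroup := by
      rw [hm_def]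
      exact AddSubgroup.nsmul_relIndex_mem _ (K := D.L.lattice.toAddSubgroup) hsz
    have h' := PeriodPair.mem_mulLeft_lattice.mp hmem
    have hrew : ((r : ℚ) : ℂ) * z = ((D.c : ℂ) * s / (D'.c : ℂ))⁻¹ * (m • (s * z)) := by
      rw [nsmul_eq_mul, hr_def]
      push_cast
      field_simp
    rw [hrew]
    exact h'
  haveI : Algebra.IsAlgebraic ℚ (AlgebraicClosure ℚ) := AlgebraicClosure.isAlgebraic ℚ
  letI : Algebra (AlgebraicClosure ℚ) ℂ :=
    (IsAlgClosed.lift : AlgebraicClosure ℚ →ₐ[ℚ] ℂ).toRingHom.toAlgebra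
  haveI : IsScalarTower ℚ (AlgebraicClosure ℚ) ℂ :=
    IsScalarTower.of_algebraMap_eq' (Subsingleton.elim _ _)
  obtain ⟨φ, -, -, -, -, hdegφ⟩ :=
    exists_isogeny_degree_eq_relIndex_of_isNeronLatticeOf hT D'.isNeronLattice hrq hle
  -- the index of `r·Λ_T` in `Λ_{W′}` is `m` (covolumes)
  have hle' : ((D.L.mulLeft s⁻¹ (inv_ne_zero hs0)).mulLeft ((r : ℚ) : ℂ) hrC).lattice ≤ D'.L.lattice := by
    intro z hz
    have := hle _ (PeriodPair.mem_mulLeft_lattice.mp hz)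
    rwa [mul_inv_cancel_left₀ hrC] at this
  have hA := norm_sq_mul_covolume_eq_relIndex_mul ht hB
  have hC := norm_sq_mul_covolume_eq_relIndex_mul hrC hle'
  rw [← hm_def] at hA
  rw [PeriodPair.covolume_mulLeft_lattice] at hC
  set V := ZLattice.covolume D.L.lattice with hV
  set V' := ZLattice.covolume D'.L.lattice with hV'
  have hVpos : 0 < V := ZLattice.covolume_pos _ _
  have hV'pos : 0 < V' := ZLattice.covolume_pos _ _
  set idx : ℕ := ((D.L.mulLeft s⁻¹ (inv_ne_zero hs0)).mulLeft ((r : ℚ) : ℂ) hrC).lattice.toAddSubgroup.relIndex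
    D'.L.lattice.toAddSubgroup with hidx_def
  -- the three norms
  have hn1 : ‖(D.c : ℂ) * s / (D'.c : ℂ)‖ ^ 2 = (D.c : ℝ) ^ 2 * a / (D'.c : ℝ) ^ 2 := by
    rw [norm_div, norm_mul, Complex.norm_intCast, Complex.norm_intCast, div_pow, mul_pow, ha, sq_abs, sq_abs]
  have hn2 : ‖((r : ℚ) : ℂ)‖ ^ 2 = (r : ℝ) ^ 2 := by
    rw [Complex.norm_ratCast, sq_abs]
  have hn3 : ‖s⁻¹‖ ^ 2 = (a : ℝ)⁻¹ := by
    rw [norm_inv, inv_pow, ha]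
  rw [hn1] at hA
  rw [hn2, hn3] at hC
  have hrR : (r : ℝ) = (m : ℝ) * (D'.c : ℝ) / (D.c : ℝ) := by
    rw [hr_def]; push_cast; ring
  rw [hrR] at hC
  have hcR : (D.c : ℝ) ≠ 0 := by exact_mod_cast (Int.cast_ne_zero.mp hc0)
  have hcR' : (D'.c : ℝ) ≠ 0 := by exact_mod_cast (Int.cast_ne_zero.mp hc0')
  -- `hA : c² a / c′² · V′ = m · V`, `hC : (m c′/c)² · a⁻¹ · V = idx · V′` ⟹ `idx = m`
  have hidx : (idx : ℝ) = m := by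
    have hmR : (m : ℝ) ≠ 0 := by exact_mod_cast hm0
    have hK : (D.c : ℝ) ^ 2 * a / (D'.c : ℝ) ^ 2 ≠ 0 :=
      div_ne_zero (mul_ne_zero (pow_ne_zero 2 hcR) ha0) (pow_ne_zero 2 hcR')
    have e1 : ((m : ℝ) * (D'.c : ℝ) / (D.c : ℝ)) ^ 2 * ((a : ℝ)⁻¹ * V) =
        ((m : ℝ) ^ 2 * V) / ((D.c : ℝ) ^ 2 * a / (D'.c : ℝ) ^ 2) := by
      field_simp
    have key : (m : ℝ) ^ 2 * V = (idx : ℝ) * ((m : ℝ) * V) := by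
      have h := hC
      rw [e1, div_eq_iff hK] at h
      calc (m : ℝ) ^ 2 * V = (idx : ℝ) * V' * ((D.c : ℝ) ^ 2 * a / (D'.c : ℝ) ^ 2) := h
        _ = (idx : ℝ) * ((D.c : ℝ) ^ 2 * a / (D'.c : ℝ) ^ 2 * V') := by ring
        _ = (idx : ℝ) * ((m : ℝ) * V) := by rw [hA]
    have hmV : (m : ℝ) * V ≠ 0 := mul_ne_zero hmR hVpos.ne'
    have h2 : (m : ℝ) * ((m : ℝ) * V) = (idx : ℝ) * ((m : ℝ) * V) := by rw [← key]; ring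
    exact (mul_right_cancel₀ hmV h2).symm
  have hidxN : idx = m := by exact_mod_cast hidx
  refine ⟨φ, ?_⟩
  rw [hdegφ, hidxN]
  exact hmdeg

/-- The quadratic Gauss sum `s = g(χ_q)` of an odd prime `q`: `s ≠ 0`, `s² = q*`, `‖s‖² = q` (tree
`gaussSum_quadraticChar_ringHomComp_sq`). [cite: SilvermanAEC2009, Thm. VI.4.1(b)] -/
theorem gaussSum_pStar_facts {q : ℕ} (hq : q.Prime) (hq2 : q ≠ 2) :
    (haveI : Fact q.Prime := ⟨hq⟩
    gaussSum ((quadraticChar (ZMod q)).ringHomComp (Int.castRingHom ℂ)) (ZMod.stdAddChar (N := q)) ≠ 0 ∧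
      gaussSum ((quadraticChar (ZMod q)).ringHomComp (Int.castRingHom ℂ)) (ZMod.stdAddChar (N := q)) ^ 2 =
        (((((-1 : ℤ) ^ (q / 2) * q : ℤ)) : ℚ) : ℂ) ∧
      ‖gaussSum ((quadraticChar (ZMod q)).ringHomComp (Int.castRingHom ℂ)) (ZMod.stdAddChar (N := q))‖ ^ 2 =
        q) := by
  haveI : Fact q.Prime := ⟨hq⟩
  have hdZ : ((-1 : ℤ) ^ (q / 2) * q : ℤ) ≠ 0 :=
    mul_ne_zero (pow_ne_zero _ (by norm_num)) (by exact_mod_cast hq.ne_zero)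
  have hd0 : ((((-1 : ℤ) ^ (q / 2) * q : ℤ)) : ℚ) ≠ 0 := by exact_mod_cast hdZ
  have hG2 : gaussSum ((quadraticChar (ZMod q)).ringHomComp (Int.castRingHom ℂ))
      (ZMod.stdAddChar (N := q)) ^ 2 = (((((-1 : ℤ) ^ (q / 2) * q : ℤ)) : ℚ) : ℂ) := by
    rw [gaussSum_quadraticChar_ringHomComp_sq q hq2]
    push_cast
    ring
  have hG0 : gaussSum ((quadraticChar (ZMod q)).ringHomComp (Int.castRingHom ℂ))
      (ZMod.stdAddChar (N := q)) ≠ 0 := by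
    intro h0
    have : (((((-1 : ℤ) ^ (q / 2) * q : ℤ)) : ℚ) : ℂ) = 0 := by rw [← hG2, h0]; simp
    exact hd0 (by exact_mod_cast this)
  have hGa : ‖gaussSum ((quadraticChar (ZMod q)).ringHomComp (Int.castRingHom ℂ))
      (ZMod.stdAddChar (N := q))‖ ^ 2 = q := by
    rw [← norm_pow, hG2]
    push_cast
    rw [norm_mul, norm_pow, norm_neg, norm_one, one_pow, one_mul, Complex.norm_natCast]
  exact ⟨hG0, hG2, hGa⟩

/-- **The `q*`-instance**: `q` odd prime, `q² ∣ N`, both data lattice-optimal at the common conductor, `W ⊗ q* ~ W′`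
⟹ a `ℚ`-isogeny `W ⊗ q* → W′` with `deg · deg φ_{W′} = q · deg φ_W` (`s` = the quadratic Gauss sum, `s² = q*`,
`‖s‖² = q`; steps `pStar_orbit_steps`); and on a FLIP orbit `deg φ_{W′} = deg φ_W`.
[cite: SilvermanAEC2009, Thm. VI.4.1(b)] [cite: Stevens1989, (5.4)–(5.5)] -/
theorem pStar_optimal_orbit_exists_isogeny_degree_mul {q : ℕ} (hq : q.Prime) (hq2 : q ≠ 2)
    {W W' : WeierstrassCurve ℚ} [W.IsElliptic] [W'.IsElliptic] [NeZero (W.conductorNorm ℤ)]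
    [NeZero (W'.conductorNorm ℤ)] (D : ModularParametrizationData W (W.conductorNorm ℤ))
    (D' : ModularParametrizationData W' (W'.conductorNorm ℤ)) (hD : IsLatticeOptimal D)
    (hD' : IsLatticeOptimal D') (hM : q ^ 2 ∣ W.conductorNorm ℤ)
    (hN : W'.conductorNorm ℤ = W.conductorNorm ℤ)
    (hiso : IsIsogenous (W.quadraticTwist ((((-1 : ℤ) ^ (q / 2) * q : ℤ)) : ℚ)) W') :
    (∃ φ : Isogeny (W.quadraticTwist ((((-1 : ℤ) ^ (q / 2) * q : ℤ)) : ℚ)) W',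
      φ.degree * D'.modularDegree = q * D.modularDegree) ∧
    ((∀ u : VariableChange ℚ, u • W.quadraticTwist ((((-1 : ℤ) ^ (q / 2) * q : ℤ)) : ℚ) ≠ W') →
      D'.modularDegree = D.modularDegree) := by
  haveI : Fact q.Prime := ⟨hq⟩
  have hdZ : ((-1 : ℤ) ^ (q / 2) * q : ℤ) ≠ 0 :=
    mul_ne_zero (pow_ne_zero _ (by norm_num)) (by exact_mod_cast hq.ne_zero)
  have hd0 : ((((-1 : ℤ) ^ (q / 2) * q : ℤ)) : ℚ) ≠ 0 := by exact_mod_cast hdZ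
  obtain ⟨hG0, hG2, hGa⟩ := gaussSum_pStar_facts hq hq2
  obtain ⟨h1, h2, hcoef⟩ := pStar_orbit_steps hq2 D D' hM hN hiso
  exact ⟨optimal_orbit_exists_isogeny_degree_mul hN D D' hD hD' hd0 hG0 hG2 hGa h1 h2 hcoef,
    fun hflip ↦ optimal_flip_modularDegree_eq hN D D' hD hD' hd0 hG0 hG2 hq hGa h1 h2 hcoef hflip⟩

/-- `(−1)^{⌊3/2⌋}·3 = −3`: the `q*`-parameter at `q = 3` is `−3` (cast bookkeeping). -/
theorem pStar_three_cast : ((((-1 : ℤ) ^ ((3 : ℕ) / 2) * ((3 : ℕ) : ℤ) : ℤ)) : ℚ) = ((-3 : ℤ) : ℚ) := by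
  norm_num

/-- **E-desc-58 `TwistingIsogenyDegreeAtThree` (PROVED BY NAME).**  On a same-conductor `χ₋₃`-orbit of optimal curves at
`9 ∣ N` there is a `ℚ`-isogeny `W ⊗ (−3) → W′` with `deg · deg φ_{W′} = 3 · deg φ_W` — the degree of desc's twisting
isogeny `D = t_{1/3} − t_{1/3}²`, obtained here from the period-lattice index engine instead of `End J₀(N)`.
[cite: SilvermanAEC2009, Thm. VI.4.1(b)] [cite: Stevens1989, (5.4)–(5.5)] -/
theorem twistingIsogenyDegreeAtThree_holds : TwistingIsogenyDegreeAtThree := by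
  intro W W' _ _ _ _ D D' hD hD' h9 hN hiso
  have h9' : 3 ^ 2 ∣ W.conductorNorm ℤ := by simpa using h9
  rw [← pStar_three_cast] at hiso ⊢
  exact (pStar_optimal_orbit_exists_isogeny_degree_mul Nat.prime_three (by norm_num) D D' hD hD' h9' hN hiso).1

/-- **E-desc-59 `FlipExactThreeIsogenyAtThree` (PROVED BY NAME).**  On a FLIP orbit (`W ⊗ (−3) ≇_ℚ W′`) at `9 ∣ N` some
`ℚ`-isogeny `W ⊗ (−3) → W′` has degree EXACTLY `3`: E-desc-58 and the an-lens's `optimal_flip_modularDegree_eq`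
(`deg φ_{W′} = deg φ_W` on flips), through desc's proved edge `exists_isogeny_degree_three_of_modularDegree_eq`.
[cite: SilvermanAEC2009, Thm. VI.4.1(b)] [cite: Pal2012, Lemma 3.1] -/
theorem flipExactThreeIsogenyAtThree_holds : FlipExactThreeIsogenyAtThree := by
  intro W W' _ _ _ _ D D' hD hD' h9 hN hiso hflip
  refine exists_isogeny_degree_three_of_modularDegree_eq twistingIsogenyDegreeAtThree_holds D D' hD hD' h9 hN hiso ?_
  have h9' : 3 ^ 2 ∣ W.conductorNorm ℤ := by simpa using h9
  rw [← pStar_three_cast] at hiso hflip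
  exact (pStar_optimal_orbit_exists_isogeny_degree_mul Nat.prime_three (by norm_num) D D' hD hD' h9' hN hiso).2 hflip

end Summit.BirchSwinnertonDyer.BirchSwinnertonDyer.Theorems.ManinLocalTwoThree

end
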